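import Mathlib
import Summits.PneNP.PneNP.Theorems.ConvexRankGatesConvexGateBlindCertificates
import Summits.PneNP.PneNP.Theorems.ConvexRankGatesConvexGateBlindFactorisation

/-!
# PneNP / ConvexRankGates — `ConvexGateBlind`: the dual base of a CONV gate and its extreme certificates

Helpers (`--supports stmt-PneNP-10680`) for the SDP (small PSD block) corner of the crux. For CONV data
`A : Fin p → Matrix (Fin q) (Fin q) ℝ`, the **normalised dual base** is
`Π*(A) = {z = (y, λ) ∈ ℝ^{p+1}_{≥0} | ∑ yᵢ tr(Aᵢ Y) + λ tr Y ≥ 0 ∀ Y ⪰ 0, ∑ z = 1}` (coordinates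
`Fin.castSucc i ↦ yᵢ`, `Fin.last p ↦ λ`):
* `convex_dualBase`, `isCompact_dualBase` (validity is an intersection of closed half-spaces);
* `exists_mem_dualBase_of_infeasible` — a rejected input of the trace-normalised gate has a normalised
  certificate `z ∈ Π*(A)` with `∑ yᵢ rᵢ + λ R < 0` (`certificate_of_infeasible_traceBounded`);
* `dualBase_nonneg_of_feasible` — weak duality on accepted inputs;
* `exists_perturb_mem_dualBase`, `eq_zero_of_mem_extremePoints_dualBase`,
  `card_support_le_of_mem_extremePoints_dualBase` — an EXTREME point of `Π*(A)` has at most `q² + 1`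
  non-zero coordinates: perturbing along any `d` supported on the support of `z` with
  `∑ dᵢ Aᵢ + d_λ I = 0` and `∑ d = 0` leaves the validity functional unchanged exactly, so extremality
  makes the linear map `d ↦ (d off support, ∑ dᵢ Aᵢ + d_λ I, ∑ d)` injective and
  `p + 1 ≤ (p + 1 - #support) + q² + 1` (a Pataki-type bound with no spectral theory).
[folklore: conic duality; Pataki 1998 for the rank/support phenomenon]
-/

namespace Summit.PneNP.PneNP.Theorems

open Matrix Finset Filter Topology

/-! ### The normalised dual base of a trace-bounded CONV gate -/

section sdpSupport

/-- The dual base `Π*(A)` is convex. [folklore] -/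
theorem convex_dualBase {p q : ℕ} (A : Fin p → Matrix (Fin q) (Fin q) ℝ) :
    Convex ℝ {z : Fin (p + 1) → ℝ | (∀ j, 0 ≤ z j) ∧
      (∀ Y : Matrix (Fin q) (Fin q) ℝ, Y.PosSemidef →
        0 ≤ ∑ i : Fin p, z (Fin.castSucc i) * (A i * Y).trace + z (Fin.last p) * Y.trace) ∧
      ∑ j, z j = 1} := by
  intro z hz z' hz' a e ha he hae
  obtain ⟨hz1, hz2, hz3⟩ := hz
  obtain ⟨hz1', hz2', hz3'⟩ := hz'
  refine ⟨fun j => ?_, fun Y hY => ?_, ?_⟩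
  · simp only [Pi.add_apply, Pi.smul_apply, smul_eq_mul]
    exact add_nonneg (mul_nonneg ha (hz1 j)) (mul_nonneg he (hz1' j))
  · have h : ∑ i : Fin p, (a • z + e • z') (Fin.castSucc i) * (A i * Y).trace +
        (a • z + e • z') (Fin.last p) * Y.trace =
        a * (∑ i : Fin p, z (Fin.castSucc i) * (A i * Y).trace + z (Fin.last p) * Y.trace) +
        e * (∑ i : Fin p, z' (Fin.castSucc i) * (A i * Y).trace + z' (Fin.last p) * Y.trace) := by
      simp only [Pi.add_apply, Pi.smul_apply, smul_eq_mul, mul_add, Finset.mul_sum]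
      have : ∀ i : Fin p, (a * z (Fin.castSucc i) + e * z' (Fin.castSucc i)) * (A i * Y).trace =
          a * (z (Fin.castSucc i) * (A i * Y).trace) + e * (z' (Fin.castSucc i) * (A i * Y).trace) :=
        fun i => by ring
      simp only [this, Finset.sum_add_distrib]
      ring
    rw [h]
    exact add_nonneg (mul_nonneg ha (hz2 Y hY)) (mul_nonneg he (hz2' Y hY))
  · have h : ∑ j, (a • z + e • z') j = a * ∑ j, z j + e * ∑ j, z' j := by
      simp only [Pi.add_apply, Pi.smul_apply, smul_eq_mul, Finset.mul_sum, ← Finset.sum_add_distrib]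
    rw [h, hz3, hz3', mul_one, mul_one, hae]

/-- The dual base `Π*(A)` is compact: the validity condition is an intersection of closed half-spaces
(one for each PSD test matrix) and the base lies in the unit cube. [folklore] -/
theorem isCompact_dualBase {p q : ℕ} (A : Fin p → Matrix (Fin q) (Fin q) ℝ) :
    IsCompact {z : Fin (p + 1) → ℝ | (∀ j, 0 ≤ z j) ∧
      (∀ Y : Matrix (Fin q) (Fin q) ℝ, Y.PosSemidef →
        0 ≤ ∑ i : Fin p, z (Fin.castSucc i) * (A i * Y).trace + z (Fin.last p) * Y.trace) ∧
      ∑ j, z j = 1} := by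
  have hbox : IsCompact (Set.pi Set.univ fun _ : Fin (p + 1) => Set.Icc (0 : ℝ) 1) :=
    isCompact_univ_pi fun _ => isCompact_Icc
  refine hbox.of_isClosed_subset ?_ ?_
  · have h1 : IsClosed {z : Fin (p + 1) → ℝ | ∀ j, 0 ≤ z j} := by
      rw [Set.setOf_forall]
      exact isClosed_iInter fun j => isClosed_le continuous_const (continuous_apply j)
    have h2 : IsClosed {z : Fin (p + 1) → ℝ | ∀ Y : Matrix (Fin q) (Fin q) ℝ, Y.PosSemidef →
        0 ≤ ∑ i : Fin p, z (Fin.castSucc i) * (A i * Y).trace + z (Fin.last p) * Y.trace} := by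
      rw [Set.setOf_forall]
      refine isClosed_iInter fun Y => ?_
      by_cases hY : Y.PosSemidef
      · have : {z : Fin (p + 1) → ℝ | Y.PosSemidef →
            0 ≤ ∑ i : Fin p, z (Fin.castSucc i) * (A i * Y).trace + z (Fin.last p) * Y.trace} =
            {z | 0 ≤ ∑ i : Fin p, z (Fin.castSucc i) * (A i * Y).trace + z (Fin.last p) * Y.trace} := by
          ext z; simp [hY]
        rw [this]
        exact isClosed_le continuous_const (by fun_prop)
      · have : {z : Fin (p + 1) → ℝ | Y.PosSemidef →
            0 ≤ ∑ i : Fin p, z (Fin.castSucc i) * (A i * Y).trace + z (Fin.last p) * Y.trace} =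
            Set.univ := Set.eq_univ_of_forall fun z h => absurd h hY
        rw [this]
        exact isClosed_univ
    have h3 : IsClosed {z : Fin (p + 1) → ℝ | ∑ j, z j = 1} :=
      isClosed_eq (by fun_prop) continuous_const
    simpa only [Set.setOf_and] using h1.inter (h2.inter h3)
  · rintro z ⟨hz1, -, hz3⟩
    simp only [Set.mem_pi, Set.mem_univ, Set.mem_Icc, forall_true_left]
    intro j
    refine ⟨hz1 j, ?_⟩
    calc z j ≤ ∑ j, z j := Finset.single_le_sum (fun j _ => hz1 j) (Finset.mem_univ j)
      _ = 1 := hz3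

/-- **Normalised certificates.** If the trace-bounded programme `{Y ⪰ 0, tr Y ≤ R, tr(Aᵢ Y) ≤ rᵢ}`
(`R > 0`) is infeasible, some `z = (y, λ) ∈ Π*(A)` has `∑ yᵢ rᵢ + λ R < 0`
(`certificate_of_infeasible_traceBounded`, normalised by `∑ y + λ > 0`). [folklore] -/
theorem exists_mem_dualBase_of_infeasible {p q : ℕ} (A : Fin p → Matrix (Fin q) (Fin q) ℝ)
    (r : Fin p → ℝ) {R : ℝ} (hR : 0 < R)
    (hinf : ¬ ∃ Y : Matrix (Fin q) (Fin q) ℝ, Y.PosSemidef ∧ Y.trace ≤ R ∧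
      ∀ i, (A i * Y).trace ≤ r i) :
    ∃ z ∈ {z : Fin (p + 1) → ℝ | (∀ j, 0 ≤ z j) ∧
      (∀ Y : Matrix (Fin q) (Fin q) ℝ, Y.PosSemidef →
        0 ≤ ∑ i : Fin p, z (Fin.castSucc i) * (A i * Y).trace + z (Fin.last p) * Y.trace) ∧
      ∑ j, z j = 1},
      ∑ i : Fin p, z (Fin.castSucc i) * r i + z (Fin.last p) * R < 0 := by
  obtain ⟨y, lam, hy, hlam, hpsd, hneg⟩ := certificate_of_infeasible_traceBounded A r hR hinf
  set s : ℝ := ∑ i, y i + lam with hs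
  have hs0 : 0 < s := by
    by_contra hcon
    have hs00 : s = 0 := le_antisymm (not_lt.1 hcon)
      (add_nonneg (Finset.sum_nonneg fun i _ => hy i) hlam)
    have hsum0 : ∑ i, y i = 0 := by linarith [Finset.sum_nonneg fun i (_ : i ∈ Finset.univ) => hy i]
    have hy0 : ∀ i, y i = 0 := fun i =>
      (Finset.sum_eq_zero_iff_of_nonneg (fun i _ => hy i)).1 hsum0 i (Finset.mem_univ i)
    have hl0 : lam = 0 := by linarith [Finset.sum_nonneg fun i (_ : i ∈ Finset.univ) => hy i]
    have : ∑ i, y i * r i + lam * R = 0 := by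
      rw [hl0, zero_mul, add_zero]
      exact Finset.sum_eq_zero fun i _ => by rw [hy0 i, zero_mul]
    linarith
  refine ⟨Fin.lastCases (lam / s) (fun i => y i / s), ⟨fun j => ?_, fun Y hY => ?_, ?_⟩, ?_⟩
  · refine Fin.lastCases ?_ (fun i => ?_) j
    · simpa using div_nonneg hlam hs0.le
    · simpa using div_nonneg (hy i) hs0.le
  · simp only [Fin.lastCases_castSucc, Fin.lastCases_last]
    have h : ∑ i : Fin p, y i / s * (A i * Y).trace + lam / s * Y.trace =
        (∑ i, y i * (A i * Y).trace + lam * Y.trace) / s := by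
      rw [add_div, Finset.sum_div]
      congr 1
      · exact Finset.sum_congr rfl fun i _ => by ring
      · ring
    rw [h]
    exact div_nonneg (hpsd Y hY) hs0.le
  · rw [Fin.sum_univ_castSucc]
    simp only [Fin.lastCases_castSucc, Fin.lastCases_last]
    rw [← Finset.sum_div, ← add_div, div_self hs0.ne']
  · simp only [Fin.lastCases_castSucc, Fin.lastCases_last]
    have h : ∑ i : Fin p, y i / s * r i + lam / s * R = (∑ i, y i * r i + lam * R) / s := by
      rw [add_div, Finset.sum_div]
      congr 1
      · exact Finset.sum_congr rfl fun i _ => by ring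
      · ring
    rw [h]
    exact div_neg_of_neg_of_pos hneg hs0

/-- **Weak duality.** Every `z = (y, λ) ∈ Π*(A)` is non-negative on the right-hand side of a feasible
trace-bounded programme: `0 ≤ ∑ yᵢ rᵢ + λ R`. [folklore] -/
theorem dualBase_nonneg_of_feasible {p q : ℕ} (A : Fin p → Matrix (Fin q) (Fin q) ℝ)
    {r : Fin p → ℝ} {R : ℝ} {z : Fin (p + 1) → ℝ} (hz : ∀ j, 0 ≤ z j)
    (hvalid : ∀ Y : Matrix (Fin q) (Fin q) ℝ, Y.PosSemidef →
      0 ≤ ∑ i : Fin p, z (Fin.castSucc i) * (A i * Y).trace + z (Fin.last p) * Y.trace)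
    (hfeas : ∃ Y : Matrix (Fin q) (Fin q) ℝ, Y.PosSemidef ∧ Y.trace ≤ R ∧ ∀ i, (A i * Y).trace ≤ r i) :
    0 ≤ ∑ i : Fin p, z (Fin.castSucc i) * r i + z (Fin.last p) * R := by
  obtain ⟨Y, hY, htr, hrows⟩ := hfeas
  have h1 := hvalid Y hY
  have h2 : ∑ i : Fin p, z (Fin.castSucc i) * (A i * Y).trace ≤ ∑ i : Fin p, z (Fin.castSucc i) * r i :=
    Finset.sum_le_sum fun i _ => mul_le_mul_of_nonneg_left (hrows i) (hz _)
  have h3 : z (Fin.last p) * Y.trace ≤ z (Fin.last p) * R := mul_le_mul_of_nonneg_left htr (hz _)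
  linarith

/-- **Perturbation inside the dual base.** If `d` vanishes wherever `z` does, satisfies
`∑ᵢ dᵢ Aᵢ + d_λ I = 0` and has coordinate sum `0`, then `z ± ε d ∈ Π*(A)` for some `ε > 0` — the
validity condition is unchanged EXACTLY (`tr((∑ dᵢ Aᵢ + d_λ I) Y) = 0`), so no spectral theory is
needed. [folklore] -/
theorem exists_perturb_mem_dualBase {p q : ℕ} (A : Fin p → Matrix (Fin q) (Fin q) ℝ)
    {z d : Fin (p + 1) → ℝ}
    (hz : z ∈ {z : Fin (p + 1) → ℝ | (∀ j, 0 ≤ z j) ∧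
      (∀ Y : Matrix (Fin q) (Fin q) ℝ, Y.PosSemidef →
        0 ≤ ∑ i : Fin p, z (Fin.castSucc i) * (A i * Y).trace + z (Fin.last p) * Y.trace) ∧
      ∑ j, z j = 1})
    (hd1 : ∀ j, z j = 0 → d j = 0)
    (hd2 : ∑ i : Fin p, d (Fin.castSucc i) • A i + d (Fin.last p) • (1 : Matrix (Fin q) (Fin q) ℝ) = 0)
    (hd3 : ∑ j, d j = 0) :
    ∃ ε : ℝ, 0 < ε ∧
      (z + ε • d) ∈ {z : Fin (p + 1) → ℝ | (∀ j, 0 ≤ z j) ∧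
        (∀ Y : Matrix (Fin q) (Fin q) ℝ, Y.PosSemidef →
          0 ≤ ∑ i : Fin p, z (Fin.castSucc i) * (A i * Y).trace + z (Fin.last p) * Y.trace) ∧
        ∑ j, z j = 1} ∧
      (z - ε • d) ∈ {z : Fin (p + 1) → ℝ | (∀ j, 0 ≤ z j) ∧
        (∀ Y : Matrix (Fin q) (Fin q) ℝ, Y.PosSemidef →
          0 ≤ ∑ i : Fin p, z (Fin.castSucc i) * (A i * Y).trace + z (Fin.last p) * Y.trace) ∧
        ∑ j, z j = 1} := by
  obtain ⟨hz1, hz2, hz3⟩ := hz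
  -- the validity functional is unchanged along `d`
  have hvan : ∀ Y : Matrix (Fin q) (Fin q) ℝ,
      ∑ i : Fin p, d (Fin.castSucc i) * (A i * Y).trace + d (Fin.last p) * Y.trace = 0 := by
    intro Y
    rw [← trace_certificateMatrix_mul, hd2, Matrix.zero_mul, Matrix.trace_zero]
  have hval : ∀ (t : ℝ) (Y : Matrix (Fin q) (Fin q) ℝ),
      ∑ i : Fin p, (z + t • d) (Fin.castSucc i) * (A i * Y).trace + (z + t • d) (Fin.last p) * Y.trace =
        ∑ i : Fin p, z (Fin.castSucc i) * (A i * Y).trace + z (Fin.last p) * Y.trace := by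
    intro t Y
    have h := hvan Y
    simp only [Pi.add_apply, Pi.smul_apply, smul_eq_mul, add_mul, Finset.sum_add_distrib]
    have h' : ∑ i : Fin p, t * d (Fin.castSucc i) * (A i * Y).trace + t * d (Fin.last p) * Y.trace =
        t * (∑ i : Fin p, d (Fin.castSucc i) * (A i * Y).trace + d (Fin.last p) * Y.trace) := by
      rw [mul_add, Finset.mul_sum]
      congr 1
      · exact Finset.sum_congr rfl fun i _ => by ring
      · ring
    rw [h, mul_zero] at h'
    linarith
  have hev : ∀ᶠ t : ℝ in 𝓝 0, (z + t • d) ∈ {z : Fin (p + 1) → ℝ | (∀ j, 0 ≤ z j) ∧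
      (∀ Y : Matrix (Fin q) (Fin q) ℝ, Y.PosSemidef →
        0 ≤ ∑ i : Fin p, z (Fin.castSucc i) * (A i * Y).trace + z (Fin.last p) * Y.trace) ∧
      ∑ j, z j = 1} := by
    have h1 : ∀ j, ∀ᶠ t : ℝ in 𝓝 0, 0 ≤ z j + t * d j := by
      intro j
      rcases (hz1 j).eq_or_lt with h | h
      · have hdj : d j = 0 := hd1 j h.symm
        exact Filter.Eventually.of_forall fun t => by rw [hdj, mul_zero, add_zero]; exact hz1 j
      · have ht : Tendsto (fun t : ℝ => z j + t * d j) (𝓝 0) (𝓝 (z j + 0 * d j)) :=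
          ((continuous_const.add (continuous_id.mul continuous_const)).tendsto 0)
        rw [zero_mul, add_zero] at ht
        exact (ht.eventually_const_lt h).mono fun t ht => ht.le
    filter_upwards [Filter.eventually_all.2 h1] with t ht1
    refine ⟨fun j => by simpa using ht1 j, fun Y hY => ?_, ?_⟩
    · rw [hval]
      exact hz2 Y hY
    · have h : ∑ j, (z + t • d) j = ∑ j, z j + t * ∑ j, d j := by
        simp only [Pi.add_apply, Pi.smul_apply, smul_eq_mul, Finset.mul_sum,
          ← Finset.sum_add_distrib]
      rw [h, hz3, hd3, mul_zero, add_zero]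
  have hneg : Tendsto (fun t : ℝ => -t) (𝓝 0) (𝓝 0) := by
    simpa using (continuous_neg : Continuous fun t : ℝ => -t).tendsto 0
  have hev' := hneg.eventually hev
  obtain ⟨ε, hε, hall⟩ := Metric.eventually_nhds_iff.1 (hev.and hev')
  have hdist : dist (ε / 2) 0 < ε := by
    rw [Real.dist_eq, sub_zero, abs_of_pos (half_pos hε)]
    exact half_lt_self hε
  obtain ⟨hplus, hminus⟩ := hall hdist
  refine ⟨ε / 2, half_pos hε, hplus, ?_⟩
  have h : z - (ε / 2) • d = z + (-(ε / 2)) • d := by rw [neg_smul, sub_eq_add_neg]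
  rw [h]
  exact hminus

/-- **Extreme points of the dual base admit no perturbation direction.** [folklore] -/
theorem eq_zero_of_mem_extremePoints_dualBase {p q : ℕ} (A : Fin p → Matrix (Fin q) (Fin q) ℝ)
    {z d : Fin (p + 1) → ℝ}
    (hz : z ∈ {z : Fin (p + 1) → ℝ | (∀ j, 0 ≤ z j) ∧
      (∀ Y : Matrix (Fin q) (Fin q) ℝ, Y.PosSemidef →
        0 ≤ ∑ i : Fin p, z (Fin.castSucc i) * (A i * Y).trace + z (Fin.last p) * Y.trace) ∧
      ∑ j, z j = 1}.extremePoints ℝ)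
    (hd1 : ∀ j, z j = 0 → d j = 0)
    (hd2 : ∑ i : Fin p, d (Fin.castSucc i) • A i + d (Fin.last p) • (1 : Matrix (Fin q) (Fin q) ℝ) = 0)
    (hd3 : ∑ j, d j = 0) : d = 0 := by
  by_contra hd
  obtain ⟨ε, hε, hplus, hminus⟩ := exists_perturb_mem_dualBase A hz.1 hd1 hd2 hd3
  have hseg : z ∈ openSegment ℝ (z - ε • d) (z + ε • d) := by
    refine ⟨1 / 2, 1 / 2, by norm_num, by norm_num, by norm_num, ?_⟩
    ext j
    simp only [Pi.add_apply, Pi.smul_apply, Pi.sub_apply, smul_eq_mul]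
    ring
  have h := hz.2 hminus hplus hseg
  have h' : ε • d = 0 := by
    have := congrArg (fun w => z - w) h
    simpa using this
  rcases smul_eq_zero.1 h' with h0 | h0
  · exact absurd h0 hε.ne'
  · exact hd h0

/-- **Support bound for extreme certificates** (a Pataki-type bound without spectral theory). An
extreme point of the dual base `Π*(A)` of a CONV gate with a `q × q` PSD block has at most `q² + 1`
non-zero coordinates: the map `d ↦ (d off the support, ∑ dᵢ Aᵢ + d_λ I, ∑ d)` is injective on
`ℝ^{p+1}` by `eq_zero_of_mem_extremePoints_dualBase`, so `p + 1 ≤ (p + 1 - #support) + q² + 1`. [folklore] -/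
theorem card_support_le_of_mem_extremePoints_dualBase {p q : ℕ}
    (A : Fin p → Matrix (Fin q) (Fin q) ℝ) {z : Fin (p + 1) → ℝ}
    (hz : z ∈ {z : Fin (p + 1) → ℝ | (∀ j, 0 ≤ z j) ∧
      (∀ Y : Matrix (Fin q) (Fin q) ℝ, Y.PosSemidef →
        0 ≤ ∑ i : Fin p, z (Fin.castSucc i) * (A i * Y).trace + z (Fin.last p) * Y.trace) ∧
      ∑ j, z j = 1}.extremePoints ℝ) :
    (univ.filter fun j => z j ≠ 0).card ≤ q * q + 1 := by
  classical
  set S : Finset (Fin (p + 1)) := univ.filter fun j => z j ≠ 0 with hS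
  let Ψ : (Fin (p + 1) → ℝ) →ₗ[ℝ] (({j // j ∉ S} → ℝ) × (Matrix (Fin q) (Fin q) ℝ × ℝ)) :=
    { toFun := fun d => (fun j => d j.1,
        (∑ i : Fin p, d (Fin.castSucc i) • A i + d (Fin.last p) • (1 : Matrix (Fin q) (Fin q) ℝ),
          ∑ j, d j))
      map_add' := fun d d' => by
        ext
        · simp
        · simp only [Pi.add_apply, add_smul, Finset.sum_add_distrib, Prod.mk_add_mk, Matrix.add_apply]
          abel_nf
        · simp [Finset.sum_add_distrib]
      map_smul' := fun a d => by
        ext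
        · simp
        · simp only [Pi.smul_apply, smul_eq_mul, RingHom.id_apply, Prod.smul_mk, mul_smul,
            ← Finset.smul_sum, smul_add]
        · simp [Finset.mul_sum] }
  have hinj : Function.Injective Ψ := by
    rw [← LinearMap.ker_eq_bot, LinearMap.ker_eq_bot']
    intro d hd
    have hd' : (fun j : {j // j ∉ S} => d j.1) = 0 ∧
        (∑ i : Fin p, d (Fin.castSucc i) • A i + d (Fin.last p) • (1 : Matrix (Fin q) (Fin q) ℝ)) = 0 ∧
        ∑ j, d j = 0 := by
      simpa [Ψ, Prod.ext_iff] using hd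
    obtain ⟨h1, h2, h3⟩ := hd'
    refine eq_zero_of_mem_extremePoints_dualBase A hz (fun j hj => ?_) h2 h3
    have hj' : j ∉ S := by simp [hS, hj]
    exact congr_fun h1 ⟨j, hj'⟩
  have hrank := LinearMap.finrank_le_finrank_of_injective hinj
  rw [Module.finrank_fintype_fun_eq_card, Fintype.card_fin, Module.finrank_prod, Module.finrank_prod,
    Module.finrank_fintype_fun_eq_card, Module.finrank_matrix, Module.finrank_self,
    Fintype.card_subtype_compl, Fintype.card_fin, Fintype.card_fin] at hrank
  have hSc : Fintype.card {j // j ∈ S} = S.card := by simp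
  rw [hSc] at hrank
  have hSp : S.card ≤ p + 1 := by
    calc S.card ≤ (univ : Finset (Fin (p + 1))).card := Finset.card_le_univ S
      _ = p + 1 := by simp
  simp only [mul_one] at hrank
  omega

end sdpSupport

end Summit.PneNP.PneNP.Theorems
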